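import Literature.Algebra.Polynomial.CasasAlvero.Degree8Char1283Closed
import Literature.Algebra.Polynomial.CasasAlvero.Degree8ScenarioCriterion
import Mathlib.Tactic.NormNum.Prime
import HarnessLib

/-!
# The Casas-Alvero conjecture in degree 8 holds in characteristic 1283

This file PROVES, kernel-checked, that `1283` is a GOOD prime for degree `8` in the sense of [CastryckLaterveerOunaies2012]
(`CA_8` holds in characteristic `1283`):

* `holdsInDegree_eight_of_char_1283` — `CA_8` over every field with `1283 = 0`: the `876` reduced scenario systems are closed there
  (`degree8ScenariosClosed_of_char_1283`, assembled from the kernel-evaluated certificates `Degree8Char1283Cert*.lean` via `CertCheck.check`),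
  and the characteristic-free criterion `Degree8ScenariosClosed.holdsInDegree_eight` (`Degree8ScenarioCriterion.lean`) applies;
* `holdsInDegree_eight_mul_pow_of_char_1283` — hence `CA_(8·1283^k)` over every field of characteristic `1283` ([GrafVonBothmerEtAl2007, Prop. 6] + descent).

In characteristic `1283` the tree also has `CA_7` (`Degree7Char1283.lean`) and the bad digits `10, …, 13` (`Char1283Digits.lean`);
`CA_9` is computed to hold there (two independent implementations of the lottery cell) but is not formalised.  The certificates were found by
linear algebra over `F_1283` (lottery cell `code/L4lean-g15/d8/certD.py`, unchanged, kit job j170262) and are re-verified by the kernel; two further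
independent implementations (chain certificates from a recording Buchberger, `code/L4lean-g19/implE/certE.py`, kit job j167485, and Gröbner bases
after elimination, `code/L4lean-g18/implC/implD_elim.py`, kit job j167598) report every degree-8 scenario closed at `p = 1283` as well.  No `sorry`, no new axioms.
-/

set_option linter.style.longLine false

noncomputable section

open Polynomial

namespace Literature.Algebra.Polynomial.CasasAlvero

variable {K : Type*} [Field K]

/-- **`CA_8` in characteristic `1283`.**  Over every field in which `1283 = 0`, a monic polynomial of degree `8` each of whose Hasse derivatives
`H_1 f, …, H_7 f` shares a root with `f` is `(X - a)^8`: `1283` is a good prime for degree `8` (it is good for degree `7` (`Degree7Char1283.lean`); its digits `10, …, 13` are bad (`Char1283Digits.lean`)).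
[cite: CastryckLaterveerOunaies2012, Sec. 2] -/
theorem holdsInDegree_eight_of_char_1283 (hp : (1283 : K) = 0) : HoldsInDegree K 8 :=
  (degree8ScenariosClosed_of_char_1283 hp).holdsInDegree_eight

/-- Hence `CA_(8·1283^k)` over every field of characteristic `1283`. [cite: CastryckLaterveerOunaies2012, Sec. 2] [cite: GrafVonBothmerEtAl2007, Prop. 6] -/
theorem holdsInDegree_eight_mul_pow_of_char_1283 [CharP K 1283] (k : ℕ) : HoldsInDegree K (8 * 1283 ^ k) := by
  haveI : Fact (Nat.Prime 1283) := ⟨by norm_num⟩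
  exact Degree8ScenariosClosed.holdsInDegree_eight_mul_prime_pow 1283
    (degree8ScenariosClosed_of_char_1283 (K := AlgebraicClosure K) (by simpa using CharP.cast_eq_zero (AlgebraicClosure K) 1283)) k

end Literature.Algebra.Polynomial.CasasAlvero
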